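import Summits.NavierStokesRegularity.NavierStokesRegularity.Theorems.CalmSliceGateOneSymmetricSlicePressure
import Literature.Analysis.FluidPDE.VeryWeakToDistributionalSix
import Mathlib.MeasureTheory.Group.Measure
import HarnessLib

/-!
# Route `CalmSliceGate`, crux `OneSymmetricSlice` (stmt-NavierStokesRegularity-24452):
# a finite-dissipation Type-I ancient mild field, paired with its weighted Riesz pressure, solves
# Navier–Stokes in 𝒟′((−2, 0) × ℝ³)

Theorems file of route `CalmSliceGate` (seat ns-lqd-p2 g4, cell ns-idea-3; `--supports` the
crux; packaging brick 2/2 for `stub_axisymTypeIExclusionStd`). Navier–Stokes regularity is NOT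
proved here; no summit is. Notation as in `…OneSymmetricSlicePressure`: `u(τ) = w(τ − 2)`, the
weighted Riesz pressure `p(τ) = (2 − τ)^{−1/4} Q(τ)`.

* `isDistributionalNSSolutionOn_slab_of_oseenForward_six` — the `(L⁶, L³)` twin of the tree's
  `isDistributionalNSSolutionOn_slab_of_oseenForward`: a continuous bounded field on `[0, S] × ℝ³`
  with weakly divergence-free slices solving the Oseen integral equation forward from `0`, in
  `L⁶` of the slab, with a pressure in `L³` of the slab whose slices solve the weak Poisson
  equation, is a distributional solution on `(0, S) × ℝ³` (KNSS bounded weak form + the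
  `(L⁶, L³)` very-weak-to-distributional upgrade `isDistributionalNSSolutionOn_slab_of_veryWeak_six`).
* `isDistributionalNSSolutionOn_window` — applied to `(u, p)` on every window `S < 2` (the Oseen
  equation of the class, shifted by `oseenDuhamel_comp_sub_right`).
* `isDistributionalNSSolutionOn_two` — glued along `S ↑ 2` (`IsDistributionalNSSolutionOn.of_exhaustion`).
* `exists_pressure_back` — shifted back (`IsDistributionalNSSolutionOn.stRescale`, unit scales):
  `(w, q)`, `q(t, x) = (−t)^{−1/4} Q(t + 2, x)`, is a distributional solution on `(−2, 0) × ℝ³`,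
  with `Q ∈ L³(ℝ × ℝ³)`.
-/

noncomputable section

-- the summit and its single sub-problem share the name (CONVENTIONS §1), as in every Theorems file
set_option linter.dupNamespace false

namespace Summit.NavierStokesRegularity.NavierStokesRegularity.Theorems.OneSymmetricSlice.Birth

open MeasureTheory Set Filter Topology Metric Function TopologicalSpace
open Literature.Analysis Literature.Analysis.FluidPDE Literature.Analysis.UnboundedOperators
open scoped ENNReal NNReal RealInnerProductSpace Laplacian

/-! ### The `(L⁶, L³)` packaging of bounded Oseen-mild fields on a window -/

/-- **A bounded Oseen-mild field on `[0, S]`, in `L⁶` of the slab, with an `L³` pressure solving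
the slice-wise weak Poisson equation, solves Navier–Stokes in `𝒟′((0, S) × ℝ³)`** — the `(L⁶, L³)`
twin of `isDistributionalNSSolutionOn_slab_of_oseenForward` (Lemarié-Rieusset 2016, Prop. 6.5;
KNSS 2009 §4 bounded weak form). [cite: LemarieRieusset2016, Def. 6.2 with Lemma 6.3 (file p. 126), (6.13) (p. 135), Prop. 6.5 with Def. 6.9 (p. 136)] -/
theorem isDistributionalNSSolutionOn_slab_of_oseenForward_six {S : ℝ} (hS : 0 < S)
    {u : ℝ → EuclideanSpace ℝ (Fin 3) → EuclideanSpace ℝ (Fin 3)}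
    (hcont : ContinuousOn (uncurry u) (Icc 0 S ×ˢ univ)) {M : ℝ}
    (hM : ∀ t ∈ Icc 0 S, ∀ x, ‖u t x‖ ≤ M) (hdiv : ∀ t ∈ Icc 0 S, IsWeaklyDivFree (u t))
    (hmild : ∀ s t : ℝ, 0 ≤ s → s < t → t ≤ S → ∀ x,
      u t x = heatExtension (u s) (t - s) x - oseenDuhamel 1 s u u t x)
    (hu6 : MemLp (uncurry u) 6 (volume.restrict (Ioo 0 S ×ˢ (univ : Set (EuclideanSpace ℝ (Fin 3))))))
    {p : ℝ → EuclideanSpace ℝ (Fin 3) → ℝ}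
    (hp3 : MemLp (uncurry p) 3 (volume.restrict (Ioo 0 S ×ˢ (univ : Set (EuclideanSpace ℝ (Fin 3))))))
    (hsl : ∀ᵐ t ∂(volume.restrict (Ioo 0 S)), ∀ φ : EuclideanSpace ℝ (Fin 3) → ℝ,
      ContDiff ℝ (⊤ : ℕ∞) φ → HasCompactSupport φ →
        ∫ x, p t x * (Δ φ) x = -∫ x, fderiv ℝ (fderiv ℝ φ) x (u t x) (u t x)) :
    IsDistributionalNSSolutionOn (slab (EuclideanSpace ℝ (Fin 3)) (Ioo 0 S) isOpen_Ioo) 1 0 u p := by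
  have hu1 : LocallyIntegrableOn (uncurry u)
      ((slab (EuclideanSpace ℝ (Fin 3)) (Ioo 0 S) isOpen_Ioo : Opens (ℝ × EuclideanSpace ℝ (Fin 3))) :
        Set (ℝ × EuclideanSpace ℝ (Fin 3))) volume :=
    locallyIntegrableOn_slab_of_memLp hu6 (by norm_num)
  have hu2m : MemLp (fun z => ‖uncurry u z‖ ^ 2) 3
      (volume.restrict (Ioo 0 S ×ˢ (univ : Set (EuclideanSpace ℝ (Fin 3))))) := by
    have h := hu6.norm_rpow_div (2 : ℝ≥0∞)
    have e : (6 : ℝ≥0∞) / 2 = 3 := by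
      rw [show (6 : ℝ≥0∞) = 3 * 2 by norm_num,
        ENNReal.mul_div_cancel_right two_ne_zero ENNReal.ofNat_ne_top]
    rw [e] at h
    simpa [Real.rpow_two] using h
  have hu2 : LocallyIntegrableOn (fun z => ‖uncurry u z‖ ^ 2)
      ((slab (EuclideanSpace ℝ (Fin 3)) (Ioo 0 S) isOpen_Ioo : Opens (ℝ × EuclideanSpace ℝ (Fin 3))) :
        Set (ℝ × EuclideanSpace ℝ (Fin 3))) volume :=
    locallyIntegrableOn_slab_of_memLp hu2m (by norm_num)
  have hp1 : LocallyIntegrableOn (uncurry p)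
      ((slab (EuclideanSpace ℝ (Fin 3)) (Ioo 0 S) isOpen_Ioo : Opens (ℝ × EuclideanSpace ℝ (Fin 3))) :
        Set (ℝ × EuclideanSpace ℝ (Fin 3))) volume :=
    locallyIntegrableOn_slab_of_memLp hp3 (by norm_num)
  have hBW := isBoundedWeakNSSolutionOn_of_oseenForward hS hcont hM hdiv hmild
  refine isDistributionalNSSolutionOn_slab_of_veryWeak_six hu6 hp3 (fun θ hθ => ?_) (fun θ hθ => ?_)
    (fun ψ hψ hdivψ => ?_)
  · exact setIntegral_inner_gradient_eq_zero_of_forall_isWeaklyDivFree hu1 hdiv hθ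
  · exact setIntegral_pressure_laplacian_eq_of_ae_slice hu1 hu2 hp1 hsl hθ
  · exact setIntegral_veryWeak_eq_zero_of_iterated hu1 hu2 hψ (hBW.2.2.2 ψ hψ hdivψ)

/-! ### The shifted stratum member on the windows `(0, S) × ℝ³`, `S < 2` -/

/-- **On every window slab `(0, S) × ℝ³`, `0 < S < 2`, the shifted member `u(τ) = w(τ − 2)` of
`𝒟_{C,K}` and its weighted Riesz pressure solve Navier–Stokes in distributions** (continuity and
boundedness `C/√(2−S)` from the class, the Oseen equation shifted by
`oseenDuhamel_comp_sub_right`, the slab integrabilities and the slice Poisson equation of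
`…OneSymmetricSlicePressure`). [cite: KochNadirashviliSereginSverak2009, §4 (arXiv:0709.3599 p. 8)] -/
theorem isDistributionalNSSolutionOn_window {C K : ℝ}
    {w : ℝ → EuclideanSpace ℝ (Fin 3) → EuclideanSpace ℝ (Fin 3)} (hw : IsTypeIAncientMild C w)
    (hD : ∀ s : ℝ, s < 0 → ∫⁻ x, ‖fderiv ℝ (w s) x‖ₑ ^ 2 ≤ ENNReal.ofReal (K / Real.sqrt (-s)))
    {Q : ℝ × EuclideanSpace ℝ (Fin 3) → ℝ} (hQ : MemLp Q 3 volume)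
    (hQsl : ∀ᵐ τ ∂(volume.restrict (Ioo (0 : ℝ) 2)),
      ∀ φ : EuclideanSpace ℝ (Fin 3) → ℝ, ContDiff ℝ (⊤ : ℕ∞) φ → HasCompactSupport φ →
        ∫ x, ((2 - τ) ^ (-(1 / 4 : ℝ)) * Q (τ, x)) * (Δ φ) x =
          -∫ x, fderiv ℝ (fderiv ℝ φ) x (w (τ - 2) x) (w (τ - 2) x))
    {S : ℝ} (hS : 0 < S) (hS2 : S < 2) :
    IsDistributionalNSSolutionOn (slab (EuclideanSpace ℝ (Fin 3)) (Ioo 0 S) isOpen_Ioo) 1 0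
      (fun τ x => w (τ - 2) x) (fun τ x => (2 - τ) ^ (-(1 / 4 : ℝ)) * Q (τ, x)) := by
  have h2S : 0 < 2 - S := by linarith
  -- continuity on the closed window
  have hcont : ContinuousOn (uncurry fun τ x => w (τ - 2) x) (Icc 0 S ×ˢ univ) := by
    have e : (uncurry fun τ x => w (τ - 2) x) =
        uncurry w ∘ fun z : ℝ × EuclideanSpace ℝ (Fin 3) => (z.1 - 2, z.2) := rfl
    rw [e]
    refine hw.continuousOn_uncurry.comp (by fun_prop) fun z hz => ?_
    exact ⟨by have := (mem_prod.1 hz).1.2; simp only [mem_Iio]; linarith, mem_univ _⟩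
  -- the bound `C/√(2-S)`
  have hM : ∀ t ∈ Icc 0 S, ∀ x, ‖w (t - 2) x‖ ≤ C / Real.sqrt (2 - S) := by
    intro t ht x
    have ht2 : t - 2 < 0 := by linarith [ht.2]
    refine (hw.norm_le ht2 x).trans ?_
    rw [show -(t - 2) = 2 - t by ring]
    exact div_le_div_of_nonneg_left hw.nonneg (Real.sqrt_pos.2 h2S)
      (Real.sqrt_le_sqrt (by linarith [ht.2]))
  have hdiv : ∀ t ∈ Icc 0 S, IsWeaklyDivFree (w (t - 2)) := fun t ht =>
    hw.isWeaklyDivFree (by linarith [ht.2])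
  -- the Oseen equation forward from `0`, shifted
  have hmild : ∀ s t : ℝ, 0 ≤ s → s < t → t ≤ S → ∀ x,
      w (t - 2) x = heatExtension (w (s - 2)) (t - s) x -
        oseenDuhamel 1 s (fun τ => w (τ - 2)) (fun τ => w (τ - 2)) t x := by
    intro s t hs hst ht x
    rw [oseenDuhamel_comp_sub_right, hw.mild_eq_heatExtension (s := s - 2) (t := t - 2)
      (by linarith) (by linarith) x, show t - 2 - (s - 2) = t - s by ring]
  exact isDistributionalNSSolutionOn_slab_of_oseenForward_six hS hcont hM hdiv hmild
    (memLp_six_window hw hD hS2) (memLp_three_window hQ hS2)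
    (ae_restrict_of_ae_restrict_of_subset (Ioo_subset_Ioo le_rfl hS2.le) hQsl)

/-! ### Gluing along `S ↑ 2` -/

/-- **`(u, p)` solves Navier–Stokes in `𝒟′((0, 2) × ℝ³)`** — gluing the windows `S = 2 − 1/(n+1)`
(`IsDistributionalNSSolutionOn.of_exhaustion`: a compact subset of the open slab has times bounded
away from `2`). [cite: CaffarelliKohnNirenberg1982, §2] -/
theorem isDistributionalNSSolutionOn_two {C K : ℝ}
    {w : ℝ → EuclideanSpace ℝ (Fin 3) → EuclideanSpace ℝ (Fin 3)} (hw : IsTypeIAncientMild C w)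
    (hD : ∀ s : ℝ, s < 0 → ∫⁻ x, ‖fderiv ℝ (w s) x‖ₑ ^ 2 ≤ ENNReal.ofReal (K / Real.sqrt (-s)))
    {Q : ℝ × EuclideanSpace ℝ (Fin 3) → ℝ} (hQ : MemLp Q 3 volume)
    (hQsl : ∀ᵐ τ ∂(volume.restrict (Ioo (0 : ℝ) 2)),
      ∀ φ : EuclideanSpace ℝ (Fin 3) → ℝ, ContDiff ℝ (⊤ : ℕ∞) φ → HasCompactSupport φ →
        ∫ x, ((2 - τ) ^ (-(1 / 4 : ℝ)) * Q (τ, x)) * (Δ φ) x =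
          -∫ x, fderiv ℝ (fderiv ℝ φ) x (w (τ - 2) x) (w (τ - 2) x)) :
    IsDistributionalNSSolutionOn (slab (EuclideanSpace ℝ (Fin 3)) (Ioo 0 2) isOpen_Ioo) 1 0
      (fun τ x => w (τ - 2) x) (fun τ x => (2 - τ) ^ (-(1 / 4 : ℝ)) * Q (τ, x)) := by
  set Sn : ℕ → ℝ := fun n => 2 - 1 / ((n : ℝ) + 1) with hSn
  have hSn0 : ∀ n, 0 < Sn n := fun n => by
    rw [hSn]; dsimp only
    have : 1 / ((n : ℝ) + 1) ≤ 1 := by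
      rw [div_le_one (by positivity)]; have := n.cast_nonneg (α := ℝ); linarith
    linarith
  have hSn2 : ∀ n, Sn n < 2 := fun n => by
    rw [hSn]; dsimp only; have : 0 < 1 / ((n : ℝ) + 1) := by positivity
    linarith
  refine IsDistributionalNSSolutionOn.of_exhaustion
    (Qn := fun n => slab (EuclideanSpace ℝ (Fin 3)) (Ioo 0 (Sn n)) isOpen_Ioo)
    (fun n => slab_mono (Ioo_subset_Ioo le_rfl (hSn2 n).le)) (fun K' hK' hK'c => ?_)
    (fun n => isDistributionalNSSolutionOn_window hw hD hQ hQsl (hSn0 n) (hSn2 n))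
  -- a compact subset of the open slab has times bounded away from `2`
  rcases eq_empty_or_nonempty K' with hKe | hKne
  · exact ⟨0, by rw [hKe]; exact empty_subset _⟩
  have hTc : IsCompact (Prod.fst '' K') := hK'c.image continuous_fst
  obtain ⟨m, hm, hmax⟩ := hTc.exists_isGreatest (hKne.image _)
  obtain ⟨z₀, hz₀, rfl⟩ := hm
  have hm2 : z₀.1 < 2 := (mem_Ioo.1 (mem_slab.1 (hK' hz₀))).2
  obtain ⟨n, hn⟩ := exists_nat_one_div_lt (show 0 < 2 - z₀.1 by linarith)
  refine ⟨n, fun z hz => mem_slab.2 ⟨(mem_Ioo.1 (mem_slab.1 (hK' hz))).1, ?_⟩⟩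
  have hzle : z.1 ≤ z₀.1 := hmax (mem_image_of_mem _ hz)
  show z.1 < 2 - 1 / ((n : ℝ) + 1)
  linarith

/-! ### Back to `w` on `(−2, 0) × ℝ³` -/

/-- **A member of `𝒟_{C,K}` paired with its weighted Riesz pressure solves Navier–Stokes in
`𝒟′((−2, 0) × ℝ³)`**: there is `Q ∈ L³(ℝ × ℝ³)` such that `(w, q)`,
`q(t, x) = (−t)^{−1/4} Q(t + 2, x)`, is a distributional solution on the slab `(−2, 0) × ℝ³`
(the shifted solution of `isDistributionalNSSolutionOn_two` transported back by the unit-scale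
case of `IsDistributionalNSSolutionOn.stRescale`). [cite: CaffarelliKohnNirenberg1982, §2] -/
theorem exists_pressure_back {C K : ℝ}
    {w : ℝ → EuclideanSpace ℝ (Fin 3) → EuclideanSpace ℝ (Fin 3)} (hw : IsTypeIAncientMild C w)
    (hD : ∀ s : ℝ, s < 0 → ∫⁻ x, ‖fderiv ℝ (w s) x‖ₑ ^ 2 ≤ ENNReal.ofReal (K / Real.sqrt (-s))) :
    ∃ Q : ℝ × EuclideanSpace ℝ (Fin 3) → ℝ, MemLp Q 3 volume ∧
      IsDistributionalNSSolutionOn (slab (EuclideanSpace ℝ (Fin 3)) (Ioo (-2) 0) isOpen_Ioo) 1 0 w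
        (fun t x => (-t) ^ (-(1 / 4 : ℝ)) * Q (t + 2, x)) := by
  obtain ⟨Q, hQ, hQsl⟩ := exists_weightedRieszPressure hw hD
  refine ⟨Q, hQ, ?_⟩
  have h := (isDistributionalNSSolutionOn_two hw hD hQ hQsl).stRescale one_pos one_pos
    (show (1 : ℝ) = 1 * 1 by norm_num) 2 (0 : EuclideanSpace ℝ (Fin 3))
  -- identify the transported data
  have eΩ : stPreimage 1 1 2 (0 : EuclideanSpace ℝ (Fin 3))
      (slab (EuclideanSpace ℝ (Fin 3)) (Ioo 0 2) isOpen_Ioo) =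
      slab (EuclideanSpace ℝ (Fin 3)) (Ioo (-2) 0) isOpen_Ioo := by
    ext z
    simp only [SetLike.mem_coe, mem_stPreimage, stAffine, mem_slab, mem_Ioo, one_mul]
    constructor
    · rintro ⟨h1, h2⟩; exact ⟨by linarith, by linarith⟩
    · rintro ⟨h1, h2⟩; exact ⟨by linarith, by linarith⟩
  have eu : ((1 : ℝ) • stPull 1 1 2 (0 : EuclideanSpace ℝ (Fin 3)) fun τ x => w (τ - 2) x) = w := by
    funext t x
    simp only [Pi.smul_apply, stPull_apply, one_mul, one_smul, zero_add]
    congr 1; ring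
  have ep : ((1 : ℝ) ^ 2 • stPull 1 1 2 (0 : EuclideanSpace ℝ (Fin 3))
      fun τ x => (2 - τ) ^ (-(1 / 4 : ℝ)) * Q (τ, x)) =
      fun t x => (-t) ^ (-(1 / 4 : ℝ)) * Q (t + 2, x) := by
    funext t x
    simp only [Pi.smul_apply, stPull_apply, one_mul, one_smul, zero_add, one_pow, smul_eq_mul]
    rw [show (2 : ℝ) - (2 + t) = -t by ring, show (2 : ℝ) + t = t + 2 by ring]
  have ef : (((1 : ℝ) ^ 2 * 1) • stPull 1 1 2 (0 : EuclideanSpace ℝ (Fin 3))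
      (0 : ℝ → EuclideanSpace ℝ (Fin 3) → EuclideanSpace ℝ (Fin 3))) = 0 := by
    funext t x; simp [stPull_apply]
  rw [eΩ, eu, ep, ef, show (1 : ℝ) * 1 / 1 = 1 by norm_num] at h
  exact h

end Summit.NavierStokesRegularity.NavierStokesRegularity.Theorems.OneSymmetricSlice.Birth

end
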